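import Mathlib.Algebra.BigOperators.Ring.Finset
import Mathlib.Algebra.Order.BigOperators.Group.Finset
import Mathlib.Data.Real.Basic
import Mathlib.Tactic
import HarnessLib

/-!
# Monotone likelihood ratio ⟹ larger means of non-decreasing functions (Lemma A(iii) of THEOREM MT)

Support file for the Sahi / Conjecture-P programme of route `PercNearOneGluingNoHeavy`
(`--supports stmt-CriticalPhenomena-4575`, prover prim-l12-p5 gen 30; proof note
`prim-l12-p5/MULTITYPE-PROOF-g30.md` §3.2, steps (i) and (iii); `prim-l12-p5/LEAN-ROADMAP-MT-g30.md` (E7)).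
No definitions, no named facts, no sorries.

In Lemma A of THEOREM MT the size laws of the `Y`-head set at `c` and `c+1` are `π_c(m) ∝ β_m (c)_m` and
`π_{c+1}(m) ∝ β_m (c+1)_m`; their likelihood ratio `(c+1)/(c+1-m)` is non-decreasing in `m` (monotone
likelihood ratio, MLR), and the level means `h(m) = E[F | |L| = m]` are non-decreasing (BBL Thm 4.19).
The conclusion `E_{π_{c+1}} h ≥ E_{π_c} h` is the following elementary fact, proved by symmetrisation
(no sign assumption on the weights is needed):

* `mlr_symmetrise` : `2·[(∑π'h)(∑π) − (∑πh)(∑π')] = ∑∑ (π'(m)π(m') − π'(m')π(m))·(h(m) − h(m'))`;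
* `mlr_sum_le` : if `π'(m')π(m) ≤ π'(m)π(m')` for `m' ≤ m` and `h` is non-decreasing on the index set,
  then `(∑ π h)·(∑ π') ≤ (∑ π' h)·(∑ π)` (cross-multiplied comparison of the two means);
* `mlr_mean_le` : the same with the means written as quotients (positive total masses).
-/

namespace Summit.CriticalPhenomena.PercolationContinuityZ3.Theorems

namespace MLRDominance

open Finset

/-- **Symmetrisation identity**:
`2·((∑ π' h)(∑ π) − (∑ π h)(∑ π')) = ∑_m ∑_{m'} (π' m · π m' − π' m' · π m)·(h m − h m')`. -/
theorem mlr_symmetrise {ι : Type*} (M : Finset ι) (π π' h : ι → ℝ) :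
    2 * ((∑ m ∈ M, π' m * h m) * (∑ m ∈ M, π m) - (∑ m ∈ M, π m * h m) * (∑ m ∈ M, π' m)) =
      ∑ m ∈ M, ∑ m' ∈ M, (π' m * π m' - π' m' * π m) * (h m - h m') := by
  have h1 : (∑ m ∈ M, π' m * h m) * (∑ m ∈ M, π m) = ∑ m ∈ M, ∑ m' ∈ M, π' m * h m * π m' := by
    rw [sum_mul_sum]
  have h2 : (∑ m ∈ M, π m * h m) * (∑ m ∈ M, π' m) = ∑ m ∈ M, ∑ m' ∈ M, π m * h m * π' m' := by
    rw [sum_mul_sum]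
  have h3 : ∑ m ∈ M, ∑ m' ∈ M, (π' m * π m' - π' m' * π m) * (h m - h m') =
      ∑ m ∈ M, ∑ m' ∈ M, (π' m * h m * π m' - π m * h m * π' m') +
        ∑ m ∈ M, ∑ m' ∈ M, (π' m' * h m' * π m - π m' * h m' * π' m) := by
    rw [← sum_add_distrib]
    refine sum_congr rfl fun m _ => ?_
    rw [← sum_add_distrib]
    refine sum_congr rfl fun m' _ => ?_
    ring
  have h4 : ∑ m ∈ M, ∑ m' ∈ M, (π' m' * h m' * π m - π m' * h m' * π' m) =
      ∑ m ∈ M, ∑ m' ∈ M, (π' m * h m * π m' - π m * h m * π' m') := by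
    rw [sum_comm]
  rw [h3, h4, h1, h2, ← sum_sub_distrib]
  have h5 : ∑ m ∈ M, ∑ m' ∈ M, (π' m * h m * π m' - π m * h m * π' m') =
      ∑ m ∈ M, (∑ m' ∈ M, π' m * h m * π m' - ∑ m' ∈ M, π m * h m * π' m') := by
    refine sum_congr rfl fun m _ => ?_
    rw [sum_sub_distrib]
  rw [h5]
  ring

/-- **MLR ⟹ larger mean of a non-decreasing function (cross-multiplied)**: if the likelihood ratio
`π'/π` is non-decreasing in the sense `π'(m')·π(m) ≤ π'(m)·π(m')` for `m' ≤ m`, and `h` is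
non-decreasing on `M`, then `(∑_M π h)(∑_M π') ≤ (∑_M π' h)(∑_M π)`. -/
theorem mlr_sum_le {ι : Type*} [LinearOrder ι] (M : Finset ι) (π π' h : ι → ℝ)
    (hmlr : ∀ m m', m' ≤ m → π' m' * π m ≤ π' m * π m')
    (hh : ∀ m ∈ M, ∀ m' ∈ M, m' ≤ m → h m' ≤ h m) :
    (∑ m ∈ M, π m * h m) * (∑ m ∈ M, π' m) ≤ (∑ m ∈ M, π' m * h m) * (∑ m ∈ M, π m) := by
  have key := mlr_symmetrise M π π' h
  have hnn : 0 ≤ ∑ m ∈ M, ∑ m' ∈ M, (π' m * π m' - π' m' * π m) * (h m - h m') := by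
    refine sum_nonneg fun m hm => sum_nonneg fun m' hm' => ?_
    rcases le_total m' m with hle | hle
    · exact mul_nonneg (by linarith [hmlr m m' hle]) (by linarith [hh m hm m' hm' hle])
    · exact mul_nonneg_of_nonpos_of_nonpos (by linarith [hmlr m' m hle]) (by linarith [hh m' hm' m hm hle])
  linarith

/-- **MLR ⟹ larger mean (quotient form)**: with positive total masses,
`(∑ π h)/(∑ π) ≤ (∑ π' h)/(∑ π')`. -/
theorem mlr_mean_le {ι : Type*} [LinearOrder ι] (M : Finset ι) (π π' h : ι → ℝ)
    (hmlr : ∀ m m', m' ≤ m → π' m' * π m ≤ π' m * π m')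
    (hh : ∀ m ∈ M, ∀ m' ∈ M, m' ≤ m → h m' ≤ h m)
    (hπ : 0 < ∑ m ∈ M, π m) (hπ' : 0 < ∑ m ∈ M, π' m) :
    (∑ m ∈ M, π m * h m) / (∑ m ∈ M, π m) ≤ (∑ m ∈ M, π' m * h m) / (∑ m ∈ M, π' m) := by
  rw [div_le_div_iff₀ hπ hπ']
  exact mlr_sum_le M π π' h hmlr hh

end MLRDominance

end Summit.CriticalPhenomena.PercolationContinuityZ3.Theorems
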